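import Literature.NumberTheory.ComplexMultiplication.FiniteQAlgebraLatticeClassesFinite
import HarnessLib

/-!
# The maximal order `Λ_max(A)` of a separable `ℚ`-algebra (Hertling–Larabi 2026b Thm. 4.8 (a), 2026 Cor. 6.2 (a))

[topic NumberTheory/ComplexMultiplication] General-`A` series (`FiniteQAlgebraLatticePowersInvertible`,
`FiniteQAlgebraLatticeClassesFinite`). Sources, VERBATIM:

C. Hertling, K. Larabi, *Conjugacy classes of regular integer matrices*, arXiv:2602.15748 (2026)
[HertlingLarabi2026b], §4, chunks p0007–p0008: «The following result is well known (e.g. [Ne99] or [BSh73]) if `A` is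
an algebraic number field. For separable `A` it follows easily, using the decomposition `A = ⊕_{j=1}^k A^{(j)}` into
algebraic number fields `A^{(j)}`. Theorem 4.8. Let `A` be separable. (a) Then there is a maximal order `Λ_max` in
`A`. […] Proof: `Λ_max := ⊕_{j=1}^k Λ_max(A^{(j)})` is an order in `A`. If `Λ` is an order in `A`, then
`Λ·1_{A^{(j)}}` is an order in `A^{(j)}`, so `Λ·1_{A^{(j)}} ⊂ Λ_max(A^{(j)})`, so `Λ ⊂ Λ_max`.»

C. Hertling, K. Larabi, *Semigroups from full lattices in commutative ℚ-algebras*, arXiv:2602.14973 (2026)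
[HertlingLarabi2026], §6, chunk p0015: «Corollary 6.2. Let `A` be separable […]. (a) `A` has a maximal order
`Λ_max(A)`, which contains all other orders. It is `Λ_max(A) = ⊕_{j=1}^k Λ_max(A^{(j)})`.» (Thm. 6.1 (a), one
field: «the set of algebraic integers in `A`»); «Remarks 6.6. (i) In the case of a separable algebra `A`, Theorem
6.5 is equivalent to Theorem 6.3 because between a given order `Λ` and the maximal order `Λ_max(A)` there are only
finitely many orders.»; and Theorem 6.4 (Fa65): «Suppose that `A` is not separable […]. Then the set
`{Γ ∈ 𝓛(A) | Γ an order, Γ ⊃ Λ}` is infinite.» (the tree's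
`FiniteQAlgebraLattice.infinite_setOf_order_of_not_isReduced`); §1, chunk p0003: «`𝒪(L) := L : L` is an order».

The tree has all of this for ONE number field (`CMAlgebraLatticeClassesFinite` §1: `𝒪_K` is a full lattice) and for
the literal product `Y = L_1 ⊕ ⋯ ⊕ L_t` (`isFullLattice_piIntegralSubmodule`,
`CMAlgebraLatticeClassesOverorders.isIntegral_of_forall_mul_mem`, `finite_setOf_subring_…`). Here: an arbitrary
finite-dimensional commutative `ℚ`-algebra `A`, `Λ_max(A) :=` the `ℤ`-submodule of `ℤ`-integral elements
(`Subalgebra.toSubmodule (integralClosure ℤ A)`, never named), separable = `IsReduced A`.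

## What is formalised

* §1 (any `A`) «`𝒪(L)` is an order» ⊆ integral elements: `Ma ⊆ M` for a full lattice `M` forces `a` integral
  (`isIntegral_of_forall_mul_mem`); `M:M ⊆ Λ_max` (`div_self_le_toSubmodule_integralClosure`); every order
  `Γ` (`1 ∈ Γ`, `ΓΓ ⊆ Γ`, full) satisfies `Γ ⊆ Λ_max` (`le_toSubmodule_integralClosure_of_one_mem`); an order exists
  (`exists_order`).
* §2 (separable `A`) **THEOREM 4.8 (a) / COROLLARY 6.2 (a): `Λ_max(A)` is a full lattice, hence an order containing
  all orders** (`isFullLattice_toSubmodule_integralClosure_of_isReduced`, `exists_maximal_order_of_isReduced`): under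
  `A ≅ ∏_𝔪 A/𝔪` the integral elements correspond to `⊕ 𝒪_{A/𝔪}` («`Λ_max(A) = ⊕_j Λ_max(A^{(j)})`»,
  `map_toSubmodule_integralClosure_eq_pi`), a full lattice by the tree's `isFullLattice_piIntegralSubmodule`.
  **REMARK 6.6 (i): the orders `Γ ⊇ Λ` of a separable `A` form a finite set** (`finite_setOf_order_of_isReduced`;
  window finiteness between `nΛ_max ⊆ Λ` and `Λ_max`).
* §3 the converse from Theorem 6.4: for non-separable `A` the integral elements do NOT form a full lattice and no
  order contains all orders (`not_isFullLattice_toSubmodule_integralClosure_of_not_isReduced`,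
  `not_exists_maximal_order_of_not_isReduced`); so **`Λ_max(A)` is an order ⟺ `A` is separable**
  (`isFullLattice_toSubmodule_integralClosure_iff_isReduced`) and **the orders above an order are finitely many ⟺
  `A` is separable** (`finite_setOf_order_iff_isReduced`).
NOT here: Thm. 4.8 (b) / Cor. 6.2 (b)(c) (invertibility over `Λ_max`, the class group as a product).

## References
* [HertlingLarabi2026b] C. Hertling, K. Larabi, arXiv:2602.15748 (2026), §4 Thm. 4.8 (a).
  [cite: HertlingLarabi2026b, §4 Thm. 4.8 (a), chunks p0007–p0008]
* [HertlingLarabi2026] C. Hertling, K. Larabi, arXiv:2602.14973 (2026), §6 Cor. 6.2 (a), Rem. 6.6 (i), Thm. 6.4.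
  [cite: HertlingLarabi2026, §6 Cor. 6.2 (a) and Rem. 6.6 (i), chunk p0015]
* [Marseglia2019] S. Marseglia, J. Lond. Math. Soc. 101 (2020), §2 («the multiplicator ring `(I : I)` is an
  over-order of `R`», over-orders of an order are finitely many), p. 4.
-/

noncomputable section

open scoped Classical Pointwise
open Submodule Module

namespace Literature.NumberTheory.ComplexMultiplication.FiniteQAlgebraLattice

open Literature.NumberTheory.Automorphic (IsFullLattice mem_units_smul_submodule_iff exists_smul_mem_of_fg
  finite_setOf_le_and_smul_mem)
open Literature.LinearAlgebra.Matrix.LatimerMacDuffeeSquarefree (isFullLattice_map)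
open Literature.LinearAlgebra.Matrix.LatimerMacDuffeeRegular (isFullLattice_span_range_basis)

variable {A : Type} [CommRing A] [Algebra ℚ A]

/-! ## §1 Orders consist of integral elements (any `A`) -/

/-- **«`𝒪(L) := L : L` is an order», so its elements are integral: if `M ⊂ A` is a full lattice and `Ma ⊆ M`,
then `a` is integral over `ℤ`** (any finite-dimensional commutative `ℚ`-algebra `A`). Proof as in the `Y`-case
(`CMAlgebraLatticeClassesOverorders.isIntegral_of_forall_mul_mem`): `k·1 ∈ M` with `k ≠ 0`, so
`𝒪(M) ⊆ (k·1)⁻¹M` is a finitely generated `ℤ`-algebra. [cite: HertlingLarabi2026, §1 («`𝒪(L) := L : L` … is an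
order»), chunk p0003; §6 Cor. 6.2 (a) («contains all other orders»), chunk p0015] [cite: Marseglia2019, §2 («`(I : I)` is an over-order»), p. 4] -/
theorem isIntegral_of_forall_mul_mem {M : Submodule ℤ A} (hM : IsFullLattice A M) {a : A}
    (ha : ∀ m ∈ M, m * a ∈ M) : IsIntegral ℤ a := by
  -- the `ℤ`-subalgebra `𝒪(M)`
  let O : Subalgebra ℤ A :=
    { carrier := {b | ∀ m ∈ M, m * b ∈ M}
      mul_mem' := fun {b c} hb hc m hm => by rw [← mul_assoc]; exact hc _ (hb m hm)
      one_mem' := fun m hm => by rw [mul_one]; exact hm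
      add_mem' := fun {b c} hb hc m hm => by rw [mul_add]; exact M.add_mem (hb m hm) (hc m hm)
      zero_mem' := fun m _ => by rw [mul_zero]; exact M.zero_mem
      algebraMap_mem' := fun k m hm => by
        rw [Algebra.algebraMap_eq_smul_one, mul_smul_comm, mul_one]
        exact M.smul_mem k hm }
  obtain ⟨k, hk, hk1⟩ := hM.2 1
  have hku : IsUnit ((k : ℤ) • (1 : A)) := by
    rw [zsmul_eq_mul, mul_one, ← map_intCast (algebraMap ℚ A) k]
    exact (((Int.cast_ne_zero (α := ℚ)).2 hk).isUnit).map _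
  have hle : Subalgebra.toSubmodule O ≤ hku.unit⁻¹ • M := by
    intro b hb
    rw [mem_units_smul_submodule_iff, inv_inv, Units.smul_def, IsUnit.unit_spec, smul_eq_mul]
    exact hb _ hk1
  have hfg : (Subalgebra.toSubmodule O).FG := by
    refine Submodule.FG.of_le ?_ hle
    rw [Units.smul_def]
    exact hM.1.map _
  exact IsIntegral.of_mem_of_fg O hfg a ha

/-- `𝒪(M) = M:M ⊆ Λ_max(A)` (the integral elements) for every full lattice `M`. [cite: HertlingLarabi2026, §6 Cor. 6.2 (a), chunk p0015] -/
theorem div_self_le_toSubmodule_integralClosure {M : Submodule ℤ A} (hM : IsFullLattice A M) :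
    M / M ≤ Subalgebra.toSubmodule (integralClosure ℤ A) := fun a ha => by
  rw [Subalgebra.mem_toSubmodule, mem_integralClosure_iff]
  refine isIntegral_of_forall_mul_mem hM fun m hm => ?_
  rw [mul_comm]
  exact Submodule.mem_div_iff_forall_mul_mem.1 ha m hm

/-- **«If `Λ` is an order in `A`, then […] `Λ ⊂ Λ_max`»: every order (`1 ∈ Γ`, `ΓΓ ⊆ Γ`, full) consists of integral
elements** — for any `A`; what is special to separable `A` is that `Λ_max` is itself an order (§2).
[cite: HertlingLarabi2026b, §4 Thm. 4.8 (a) (proof), chunk p0008] [cite: HertlingLarabi2026, §6 Cor. 6.2 (a), chunk p0015] -/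
theorem le_toSubmodule_integralClosure_of_mul_le {Γ : Submodule ℤ A} (hΓ : IsFullLattice A Γ) (hΓΓ : Γ * Γ ≤ Γ) :
    Γ ≤ Subalgebra.toSubmodule (integralClosure ℤ A) := fun a ha => by
  rw [Subalgebra.mem_toSubmodule, mem_integralClosure_iff]
  exact isIntegral_of_forall_mul_mem hΓ fun m hm => hΓΓ (Submodule.mul_mem_mul hm ha)

/-- Orders exist in every `A`: `𝒪(M)` of the `ℤ`-span `M` of a `ℚ`-basis (a full lattice) is one («`𝒪(L) := L : L`
is an order. It is called the order of `L`»). [cite: HertlingLarabi2026, §1, chunk p0003] [cite: HertlingLarabi2026b, §4 Lemma 4.2 (a), chunk p0007] -/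
theorem exists_order [Module.Finite ℚ A] :
    ∃ Λ : Submodule ℤ A, IsFullLattice A Λ ∧ (1 : A) ∈ Λ ∧ Λ * Λ ≤ Λ := by
  have hM := isFullLattice_span_range_basis (Module.finBasis ℚ A)
  exact ⟨_, isFullLattice_div hM hM, one_mem_div_self _, (div_self_mul_div_self _).le⟩

/-! ## §2 Separable `A`: `Λ_max(A)` is an order containing all orders; finitely many orders above an order -/

/-- Componentwise integral elements of a product of number fields are integral (they lie in the finitely generated
`ℤ`-algebra `⊕ 𝒪_{L_i}`). [cite: HertlingLarabi2026, §6 Cor. 6.2 (a) («`Λ_max(A) = ⊕_j Λ_max(A^{(j)})`»), chunk p0015] -/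
theorem isIntegral_of_forall_isIntegral_apply {t : Type} {L : t → Type} [∀ i, Field (L i)] [∀ i, NumberField (L i)]
    [Fintype t] {y : Π i, L i} (hy : ∀ i, IsIntegral ℤ (y i)) : IsIntegral ℤ y := by
  let O : Subalgebra ℤ (Π i, L i) :=
    { carrier := {z | ∀ i, IsIntegral ℤ (z i)}
      mul_mem' := fun {b c} hb hc i => by rw [Pi.mul_apply]; exact (hb i).mul (hc i)
      one_mem' := fun i => by rw [Pi.one_apply]; exact isIntegral_one
      add_mem' := fun {b c} hb hc i => by rw [Pi.add_apply]; exact (hb i).add (hc i)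
      zero_mem' := fun i => by rw [Pi.zero_apply]; exact isIntegral_zero
      algebraMap_mem' := fun k i => by rw [Pi.algebraMap_apply]; exact isIntegral_algebraMap }
  have hO : Subalgebra.toSubmodule O =
      Submodule.pi Set.univ (fun i => Subalgebra.toSubmodule (integralClosure ℤ (L i))) := by
    ext z
    rw [mem_piIntegralSubmodule_iff]
    rfl
  have hfg : (Subalgebra.toSubmodule O).FG := by
    rw [hO]
    exact (isFullLattice_piIntegralSubmodule (L := L)).1
  exact IsIntegral.of_mem_of_fg O hfg y hy

omit [Algebra ℚ A] in
/-- «`Λ_max(A) = ⊕_{j=1}^k Λ_max(A^{(j)})`»: under a ring isomorphism `e : A ≅ ∏_i L_i` onto a product of number fields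
the integral elements of `A` are carried onto `⊕_i 𝒪_{L_i}`. [cite: HertlingLarabi2026, §6 Cor. 6.2 (a), chunk p0015]
[cite: HertlingLarabi2026b, §4 Thm. 4.8 (proof: «`Λ_max := ⊕_j Λ_max(A^{(j)})` is an order in `A`»), chunk p0008] -/
theorem map_toSubmodule_integralClosure_eq_pi {t : Type} {L : t → Type} [∀ i, Field (L i)]
    [∀ i, NumberField (L i)] [Fintype t] (e : A ≃+* Π i, L i) :
    (Subalgebra.toSubmodule (integralClosure ℤ A)).map (e : A →+ Π i, L i).toIntLinearMap =
      Submodule.pi Set.univ (fun i => Subalgebra.toSubmodule (integralClosure ℤ (L i))) := by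
  ext y
  rw [mem_piIntegralSubmodule_iff, Submodule.mem_map]
  constructor
  · rintro ⟨x, hx, rfl⟩ i
    rw [Subalgebra.mem_toSubmodule, mem_integralClosure_iff] at hx
    exact (map_isIntegral_int e hx).map (Pi.evalAlgHom ℤ L i)
  · intro hy
    refine ⟨e.symm y, ?_, by simp⟩
    rw [Subalgebra.mem_toSubmodule, mem_integralClosure_iff]
    exact map_isIntegral_int e.symm (isIntegral_of_forall_isIntegral_apply hy)

/-- **THEOREM 4.8 (a) / COROLLARY 6.2 (a), the lattice statement: for separable `A` the integral elements
`Λ_max(A)` form a FULL LATTICE** (finitely generated, `ℚΛ_max = A`) — via `A ≅ ∏_𝔪 A/𝔪` and `⊕ 𝒪_{A/𝔪}`.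
[cite: HertlingLarabi2026b, §4 Thm. 4.8 (a), chunks p0007–p0008] [cite: HertlingLarabi2026, §6 Cor. 6.2 (a), chunk p0015] -/
theorem isFullLattice_toSubmodule_integralClosure_of_isReduced [Module.Finite ℚ A] [IsReduced A] :
    IsFullLattice A (Subalgebra.toSubmodule (integralClosure ℤ A)) := by
  haveI : IsArtinianRing A := IsArtinianRing.of_finite ℚ A
  letI : Fintype (MaximalSpectrum A) := Fintype.ofFinite _
  letI : ∀ i : MaximalSpectrum A, Field (A ⧸ i.asIdeal) := fun i => Ideal.Quotient.field i.asIdeal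
  haveI : ∀ i : MaximalSpectrum A, NumberField (A ⧸ i.asIdeal) := fun i =>
    { to_charZero := algebraRat.charZero (A ⧸ i.asIdeal)
      to_finiteDimensional := by
        convert! (inferInstance : Module.Finite ℚ (A ⧸ i.asIdeal))
        exact Subsingleton.elim _ _ }
  let e : A ≃+* (Π i : MaximalSpectrum A, A ⧸ i.asIdeal) := (IsArtinianRing.equivPi A).toRingEquiv
  have h := isFullLattice_map e.symm (isFullLattice_piIntegralSubmodule (L := fun i : MaximalSpectrum A => A ⧸ i.asIdeal))
  rw [← map_toSubmodule_integralClosure_eq_pi e, ← Submodule.map_comp] at h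
  convert h using 1
  ext x
  simp only [Submodule.mem_map, LinearMap.coe_comp, Function.comp_apply]
  constructor
  · intro hx
    exact ⟨x, hx, by simp⟩
  · rintro ⟨z, hz, rfl⟩
    simpa using hz

/-- **THEOREM 4.8 (a): «Let `A` be separable. Then there is a maximal order `Λ_max` in `A`»; COROLLARY 6.2 (a): «`A` has
a maximal order `Λ_max(A)`, which contains all other orders»** — `Λ_max(A)` = the integral elements: a full lattice
with `1 ∈ Λ_max`, `Λ_maxΛ_max ⊆ Λ_max`, containing every order. [cite: HertlingLarabi2026b, §4 Thm. 4.8 (a), chunks p0007–p0008]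
[cite: HertlingLarabi2026, §6 Cor. 6.2 (a), chunk p0015] -/
theorem exists_maximal_order_of_isReduced [Module.Finite ℚ A] [IsReduced A] :
    ∃ Λmax : Submodule ℤ A, IsFullLattice A Λmax ∧ (1 : A) ∈ Λmax ∧ Λmax * Λmax ≤ Λmax ∧
      ∀ Γ : Submodule ℤ A, IsFullLattice A Γ → Γ * Γ ≤ Γ → Γ ≤ Λmax :=
  ⟨Subalgebra.toSubmodule (integralClosure ℤ A), isFullLattice_toSubmodule_integralClosure_of_isReduced,
    Subalgebra.one_mem _, Submodule.mul_le.2 fun _ ha _ hb => Subalgebra.mul_mem _ ha hb,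
    fun _ hΓ hΓΓ => le_toSubmodule_integralClosure_of_mul_le hΓ hΓΓ⟩

/-- **REMARK 6.6 (i): «between a given order `Λ` and the maximal order `Λ_max(A)` there are only finitely many
orders»** — for separable `A` and any full lattice `Λ`, the multiplicatively closed full lattices `Γ ⊇ Λ` form a
finite set (`nΛ_max ⊆ Λ ⊆ Γ ⊆ Λ_max`, window finiteness). [cite: HertlingLarabi2026, §6 Rem. 6.6 (i), chunk p0015]
[cite: HertlingLarabi2026b, §5 Cor. 5.4 (proof: «there are only finitely many orders `Λ̃` with `Λ̃ ⊃ Λ`»), chunk p0009] [cite: Marseglia2019, §2 (over-orders), p. 4] -/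
theorem finite_setOf_order_of_isReduced [Module.Finite ℚ A] [IsReduced A] {Λ : Submodule ℤ A}
    (hΛ : IsFullLattice A Λ) :
    {Γ : Submodule ℤ A | Λ ≤ Γ ∧ IsFullLattice A Γ ∧ Γ * Γ ≤ Γ}.Finite := by
  haveI : IsAddTorsionFree A := IsAddTorsionFree.of_isTorsionFree ℚ A
  have hmax := isFullLattice_toSubmodule_integralClosure_of_isReduced (A := A)
  obtain ⟨n, hn, hnΛ⟩ := exists_smul_mem_of_fg hΛ hmax.1
  refine (finite_setOf_le_and_smul_mem _ hmax.1 hn).subset ?_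
  rintro Γ ⟨hΛΓ, hΓ, hΓΓ⟩
  exact ⟨le_toSubmodule_integralClosure_of_mul_le hΓ hΓΓ, fun x hx => hΛΓ (hnΛ x hx)⟩

/-! ## §3 Non-separable `A`: no maximal order -/

/-- **For non-separable `A` the integral elements do NOT form a full lattice** (else window finiteness would bound
the orders above an order, contradicting Theorem 6.4 (Fa65): «the set `{Γ ∈ 𝓛(A) | Γ an order, Γ ⊃ Λ}` is
infinite»). [cite: HertlingLarabi2026, §6 Thm. 6.4 and Rem. 6.6 (i), chunk p0015] -/
theorem not_isFullLattice_toSubmodule_integralClosure_of_not_isReduced [Module.Finite ℚ A] (hA : ¬IsReduced A) :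
    ¬IsFullLattice A (Subalgebra.toSubmodule (integralClosure ℤ A)) := fun hmax => by
  haveI : IsAddTorsionFree A := IsAddTorsionFree.of_isTorsionFree ℚ A
  obtain ⟨Λ, hΛ, h1, hΛΛ⟩ := exists_order (A := A)
  obtain ⟨n, hn, hnΛ⟩ := exists_smul_mem_of_fg hΛ hmax.1
  refine infinite_setOf_order_of_not_isReduced hA hΛ h1 hΛΛ
    ((finite_setOf_le_and_smul_mem _ hmax.1 hn).subset ?_)
  rintro Γ ⟨hΛΓ, hΓ, -, hΓΓ⟩
  exact ⟨le_toSubmodule_integralClosure_of_mul_le hΓ hΓΓ, fun x hx => hΛΓ (hnΛ x hx)⟩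

/-- **For non-separable `A` there is no maximal order**: no multiplicatively closed full lattice contains all orders.
[cite: HertlingLarabi2026, §6 Thm. 6.4, chunk p0015] -/
theorem not_exists_maximal_order_of_not_isReduced [Module.Finite ℚ A] (hA : ¬IsReduced A) :
    ¬∃ Λmax : Submodule ℤ A, IsFullLattice A Λmax ∧ Λmax * Λmax ≤ Λmax ∧
      ∀ Γ : Submodule ℤ A, IsFullLattice A Γ → (1 : A) ∈ Γ → Γ * Γ ≤ Γ → Γ ≤ Λmax := by
  rintro ⟨Λmax, hmax, -, hall⟩
  haveI : IsAddTorsionFree A := IsAddTorsionFree.of_isTorsionFree ℚ A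
  obtain ⟨Λ, hΛ, h1, hΛΛ⟩ := exists_order (A := A)
  obtain ⟨n, hn, hnΛ⟩ := exists_smul_mem_of_fg hΛ hmax.1
  refine infinite_setOf_order_of_not_isReduced hA hΛ h1 hΛΛ
    ((finite_setOf_le_and_smul_mem _ hmax.1 hn).subset ?_)
  rintro Γ ⟨hΛΓ, hΓ, hΓ1, hΓΓ⟩
  exact ⟨hall Γ hΓ hΓ1 hΓΓ, fun x hx => hΛΓ (hnΛ x hx)⟩

/-- **`Λ_max(A)` (the integral elements) is a full lattice — equivalently an order, the maximal one — iff `A` is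
separable.** [cite: HertlingLarabi2026b, §4 Thm. 4.8 (a), chunk p0007] [cite: HertlingLarabi2026, §6 Cor. 6.2 (a) and Thm. 6.4, chunk p0015] -/
theorem isFullLattice_toSubmodule_integralClosure_iff_isReduced [Module.Finite ℚ A] :
    IsFullLattice A (Subalgebra.toSubmodule (integralClosure ℤ A)) ↔ IsReduced A :=
  ⟨fun h => by_contra fun hA => not_isFullLattice_toSubmodule_integralClosure_of_not_isReduced hA h,
    fun hA => by haveI := hA; exact isFullLattice_toSubmodule_integralClosure_of_isReduced⟩

/-- **The orders above an order are finitely many iff `A` is separable** (Remark 6.6 (i) and Theorem 6.4 together).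
[cite: HertlingLarabi2026, §6 Rem. 6.6 (i) and Thm. 6.4, chunk p0015] -/
theorem finite_setOf_order_iff_isReduced [Module.Finite ℚ A] {Λ : Submodule ℤ A} (hΛ : IsFullLattice A Λ)
    (h1 : (1 : A) ∈ Λ) (hΛΛ : Λ * Λ ≤ Λ) :
    {Γ : Submodule ℤ A | Λ ≤ Γ ∧ IsFullLattice A Γ ∧ (1 : A) ∈ Γ ∧ Γ * Γ ≤ Γ}.Finite ↔ IsReduced A := by
  refine ⟨fun h => by_contra fun hA => infinite_setOf_order_of_not_isReduced hA hΛ h1 hΛΛ h, fun hA => ?_⟩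
  haveI := hA
  exact (finite_setOf_order_of_isReduced hΛ).subset fun Γ ⟨hΛΓ, hΓ, _, hΓΓ⟩ => ⟨hΛΓ, hΓ, hΓΓ⟩

end Literature.NumberTheory.ComplexMultiplication.FiniteQAlgebraLattice
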